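import Mathlib
import Summits.Ventures.PercRepro.TriangleCapTwoTrianglesB
import Summits.Ventures.PercRepro.TriangleCapPairwise

/-!
# PercRepro — the two-triangle case of the dense-corner stability below `k = 10`, part C: the hanging case
and the dichotomy when neither triangle has an outer vertex (p3, gen 35; part 35c; `deg_le_card_sub_one` from TriangleCapPairwise)

* `card_edges_le_of_hang` — triangles `u v w`, `u b c` sharing `u`, every triangle vertex in
  `S = {u, v, w, b, c}`, no outer vertex for either, no vertex off `S` with two distinct neighbours in `S`:
  every vertex off `S` hangs on `u` alone and `m ≤ k + 1` (degrees `k − 1, 2, 2, 2, 2, 1, …, 1`);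
* `exists_not_six` — `k ≥ 7` leaves a vertex off six;
* **`two_triangles_no_outer`** — for `k ≥ 7`, two triangles `u v w`, `a b c` (`a ∉ {u, v, w}`) with every
  triangle vertex in `S` and no outer vertex for either: `Σ_{codeg = 0} deficit ≥ 4` or `m ≤ k + 1`
  (the neighbour of a vertex off `S` in the first triangle equals its neighbour in the second, which is the
  shared vertex — six labelings of `card_edges_le_of_hang`).

Axioms: standard.
-/

namespace PercRepro

namespace TriangleCap

namespace C047

open Finset

variable {V : Type*} [Fintype V] [DecidableEq V]

/-- **THE HANGING CASE:** triangles `u v w` and `u b c` sharing `u`, every triangle vertex in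
`S = {u, v, w, b, c}`, no outer vertex for either triangle, and no vertex off `S` with two distinct neighbours
in `S`: then every vertex off `S` hangs on `u` alone and `m ≤ k + 1`. -/
theorem card_edges_le_of_hang (D : SimpleGraph V) [DecidableRel D.Adj] (hK : K4mFree D) {u v w b c : V}
    (huv : D.Adj u v) (huw : D.Adj u w) (hvw : D.Adj v w) (hub : D.Adj u b) (huc : D.Adj u c)
    (hbc : D.Adj b c) (hvb : v ≠ b) (hvc : v ≠ c) (hwb : w ≠ b) (hwc : w ≠ c)
    (hS : ∀ x y z, D.Adj x y → D.Adj x z → D.Adj y z → x = u ∨ x = v ∨ x = w ∨ x = b ∨ x = c)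
    (hO1 : outer D u v w = ∅) (hO2 : outer D u b c = ∅)
    (hno : ∀ r, ¬ (r = u ∨ r = v ∨ r = w ∨ r = b ∨ r = c) → ∀ y₁ y₂,
      (y₁ = u ∨ y₁ = v ∨ y₁ = w ∨ y₁ = b ∨ y₁ = c) → (y₂ = u ∨ y₂ = v ∨ y₂ = w ∨ y₂ = b ∨ y₂ = c) →
      D.Adj r y₁ → D.Adj r y₂ → y₁ = y₂) :
    D.edgeFinset.card ≤ Fintype.card V + 1 := by
  have huv' := huv.ne
  have huw' := huw.ne
  have hvw' := hvw.ne
  have hub' := hub.ne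
  have huc' := huc.ne
  have hbc' := hbc.ne
  -- every vertex off `S` is adjacent to `u`
  have step1 : ∀ r, ¬ (r = u ∨ r = v ∨ r = w ∨ r = b ∨ r = c) → D.Adj r u := by
    intro r hr
    have hr1 : r ∉ outer D u v w := by rw [hO1]; exact notMem_empty r
    have hr2 : r ∉ outer D u b c := by rw [hO2]; exact notMem_empty r
    have h1 := adj_of_not_outer D hr1
    have h2 := adj_of_not_outer D hr2
    rcases h1 with h1 | h1 | h1
    · exact h1.symm
    · rcases h2 with h2 | h2 | h2
      · exact h2.symm
      · exact (hvb (hno r hr v b (by simp) (by simp) h1.symm h2.symm)).elim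
      · exact (hvc (hno r hr v c (by simp) (by simp) h1.symm h2.symm)).elim
    · rcases h2 with h2 | h2 | h2
      · exact h2.symm
      · exact (hwb (hno r hr w b (by simp) (by simp) h1.symm h2.symm)).elim
      · exact (hwc (hno r hr w c (by simp) (by simp) h1.symm h2.symm)).elim
  -- every neighbour of a vertex off `S` is `u`
  have step2 : ∀ r, ¬ (r = u ∨ r = v ∨ r = w ∨ r = b ∨ r = c) → ∀ y, D.Adj r y → y = u := by
    intro r hr y hy
    by_cases hyS : y = u ∨ y = v ∨ y = w ∨ y = b ∨ y = c
    · exact (hno r hr u y (by simp) hyS (step1 r hr) hy).symm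
    · exfalso
      have h1 := step1 r hr
      have h2 := step1 y hyS
      exact hr (hS r y u hy h1 h2)
  -- the pointwise degree bound
  have hdeg : ∀ x, deg D x ≤ (if x = u then Fintype.card V - 1 else 0) + (if x = v then 2 else 0) +
      (if x = w then 2 else 0) + (if x = b then 2 else 0) + (if x = c then 2 else 0) +
      (if ¬ (x = u ∨ x = v ∨ x = w ∨ x = b ∨ x = c) then 1 else 0) := by
    intro x
    by_cases hxu : x = u
    · subst hxu
      have h := deg_le_card_sub_one D x
      simp [huv', huw', hub', huc']
      exact h
    by_cases hxv : x = v
    · subst hxv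
      simp [hxu, hvw', hvb, hvc]
      have hsub : ∀ y, D.Adj x y → y ∈ ({u, w} : Finset V) := by
        intro y hy
        by_cases hyS : y = u ∨ y = x ∨ y = w ∨ y = b ∨ y = c
        · rcases hyS with rfl | rfl | rfl | rfl | rfl
          · simp
          · exact (hy.ne rfl).elim
          · simp
          · exact (not_adj_both D hK huv huw hvw hwb hub hy).elim
          · exact (not_adj_both D hK huv huw hvw hwc huc hy).elim
        · exact (hxu (step2 y hyS x hy.symm)).elim
      exact le_trans (deg_le_of_subset D x _ hsub) card_le_two
    by_cases hxw : x = w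
    · subst hxw
      simp [hxu, hxv, hwb, hwc]
      have hsub : ∀ y, D.Adj x y → y ∈ ({u, v} : Finset V) := by
        intro y hy
        by_cases hyS : y = u ∨ y = v ∨ y = x ∨ y = b ∨ y = c
        · rcases hyS with rfl | rfl | rfl | rfl | rfl
          · simp
          · simp
          · exact (hy.ne rfl).elim
          · exact (not_adj_both D hK huw huv hvw.symm hvb hub hy).elim
          · exact (not_adj_both D hK huw huv hvw.symm hvc huc hy).elim
        · exact (hxu (step2 y hyS x hy.symm)).elim
      exact le_trans (deg_le_of_subset D x _ hsub) card_le_two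
    by_cases hxb : x = b
    · subst hxb
      simp [hxu, hxv, hxw, hbc']
      have hsub : ∀ y, D.Adj x y → y ∈ ({u, c} : Finset V) := by
        intro y hy
        by_cases hyS : y = u ∨ y = v ∨ y = w ∨ y = x ∨ y = c
        · rcases hyS with rfl | rfl | rfl | rfl | rfl
          · simp
          · exact (not_adj_both D hK hub huc hbc (Ne.symm hvc) huv hy).elim
          · exact (not_adj_both D hK hub huc hbc (Ne.symm hwc) huw hy).elim
          · exact (hy.ne rfl).elim
          · simp
        · exact (hxu (step2 y hyS x hy.symm)).elim
      exact le_trans (deg_le_of_subset D x _ hsub) card_le_two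
    by_cases hxc : x = c
    · subst hxc
      simp [hxu, hxv, hxw, hxb]
      have hsub : ∀ y, D.Adj x y → y ∈ ({u, b} : Finset V) := by
        intro y hy
        by_cases hyS : y = u ∨ y = v ∨ y = w ∨ y = b ∨ y = x
        · rcases hyS with rfl | rfl | rfl | rfl | rfl
          · simp
          · exact (not_adj_both D hK huc hub hbc.symm (Ne.symm hvb) huv hy).elim
          · exact (not_adj_both D hK huc hub hbc.symm (Ne.symm hwb) huw hy).elim
          · simp
          · exact (hy.ne rfl).elim
        · exact (hxu (step2 y hyS x hy.symm)).elim
      exact le_trans (deg_le_of_subset D x _ hsub) card_le_two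
    have hxS : ¬ (x = u ∨ x = v ∨ x = w ∨ x = b ∨ x = c) := by
      rintro (h | h | h | h | h)
      exacts [hxu h, hxv h, hxw h, hxb h, hxc h]
    simp [hxu, hxv, hxw, hxb, hxc]
    have hsub : ∀ y, D.Adj x y → y ∈ ({u} : Finset V) := by
      intro y hy
      rw [mem_singleton]
      exact step2 x hxS y hy
    exact le_trans (deg_le_of_subset D x _ hsub) (by rw [card_singleton])
  -- the pointwise partition identity
  have hpart : ∀ x, (if x = u then 1 else 0) + (if x = v then 1 else 0) + (if x = w then 1 else 0) +
      (if x = b then 1 else 0) + (if x = c then 1 else 0) +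
      (if ¬ (x = u ∨ x = v ∨ x = w ∨ x = b ∨ x = c) then 1 else 0) = 1 := by
    intro x
    by_cases hxu : x = u
    · subst hxu; simp [huv', huw', hub', huc']
    by_cases hxv : x = v
    · subst hxv; simp [hxu, hvw', hvb, hvc]
    by_cases hxw : x = w
    · subst hxw; simp [hxu, hxv, hwb, hwc]
    by_cases hxb : x = b
    · subst hxb; simp [hxu, hxv, hxw, hbc']
    by_cases hxc : x = c
    · subst hxc; simp [hxu, hxv, hxw, hxb]
    simp [hxu, hxv, hxw, hxb, hxc]
  have hsum := sum_le_sum (fun x (_ : x ∈ univ) => hdeg x)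
  have hsum2 := sum_congr rfl (fun x (_ : x ∈ univ) => hpart x)
  rw [sum_deg_eq] at hsum
  simp only [sum_add_distrib, sum_ite_eq', mem_univ, if_true, sum_const, card_univ, smul_eq_mul,
    mul_one] at hsum hsum2
  omega

/-- `k ≥ 7` leaves a vertex off the six. -/
theorem exists_not_six (hk : 7 ≤ Fintype.card V) (u v w a b c : V) :
    ∃ r, ¬ (r = u ∨ r = v ∨ r = w ∨ r = a ∨ r = b ∨ r = c) := by
  by_contra h
  have h' : ∀ x, x = u ∨ x = v ∨ x = w ∨ x = a ∨ x = b ∨ x = c := fun x => by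
    by_contra hx
    exact h ⟨x, hx⟩
  have hsub : (univ : Finset V) ⊆ {u, v, w, a, b, c} := by
    intro x _
    simp only [mem_insert, mem_singleton]
    exact h' x
  have := le_trans (card_le_card hsub) card_le_six
  rw [card_univ] at this
  omega

/-- **NO OUTER VERTEX FOR EITHER TRIANGLE (`k ≥ 7`):** `Σ_{codeg = 0} deficit ≥ 4` or `m ≤ k + 1`. -/
theorem two_triangles_no_outer (D : SimpleGraph V) [DecidableRel D.Adj] (hK : K4mFree D)
    (hk : 7 ≤ Fintype.card V) {u v w a b c : V}
    (huv : D.Adj u v) (huw : D.Adj u w) (hvw : D.Adj v w) (hab : D.Adj a b) (hac : D.Adj a c)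
    (hbc : D.Adj b c) (ha : ¬ (a = u ∨ a = v ∨ a = w))
    (hS : ∀ x y z, D.Adj x y → D.Adj x z → D.Adj y z → x = u ∨ x = v ∨ x = w ∨ x = a ∨ x = b ∨ x = c)
    (hO1 : outer D u v w = ∅) (hO2 : outer D a b c = ∅) :
    4 ≤ ∑ p ∈ adjPairsAll D, (if codeg D p = 0 then deficit D p else 0) ∨
      D.edgeFinset.card ≤ Fintype.card V + 1 := by
  by_cases hex : ∃ r, ¬ (r = u ∨ r = v ∨ r = w ∨ r = a ∨ r = b ∨ r = c) ∧ ∃ y₁ y₂,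
      (y₁ = u ∨ y₁ = v ∨ y₁ = w ∨ y₁ = a ∨ y₁ = b ∨ y₁ = c) ∧
      (y₂ = u ∨ y₂ = v ∨ y₂ = w ∨ y₂ = a ∨ y₂ = b ∨ y₂ = c) ∧ y₁ ≠ y₂ ∧ D.Adj r y₁ ∧ D.Adj r y₂
  · obtain ⟨r, hr, y₁, y₂, hy₁, hy₂, h12, hry₁, hry₂⟩ := hex
    exact Or.inl (four_le_of_two_nbrs D hK huv huw hvw hab hac hbc hS hr hy₁ hy₂ h12 hry₁ hry₂)
  · right
    have hno : ∀ r, ¬ (r = u ∨ r = v ∨ r = w ∨ r = a ∨ r = b ∨ r = c) → ∀ y₁ y₂,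
        (y₁ = u ∨ y₁ = v ∨ y₁ = w ∨ y₁ = a ∨ y₁ = b ∨ y₁ = c) →
        (y₂ = u ∨ y₂ = v ∨ y₂ = w ∨ y₂ = a ∨ y₂ = b ∨ y₂ = c) → D.Adj r y₁ → D.Adj r y₂ → y₁ = y₂ := by
      intro r hr y₁ y₂ hy₁ hy₂ h1 h2
      by_contra hne
      exact hex ⟨r, hr, y₁, y₂, hy₁, hy₂, hne, h1, h2⟩
    obtain ⟨r, hr⟩ := exists_not_six hk u v w a b c
    have hr1 : r ∉ outer D u v w := by rw [hO1]; exact notMem_empty r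
    have hr2 : r ∉ outer D a b c := by rw [hO2]; exact notMem_empty r
    have hau : a ≠ u := fun h => ha (Or.inl h)
    have hav : a ≠ v := fun h => ha (Or.inr (Or.inl h))
    have haw : a ≠ w := fun h => ha (Or.inr (Or.inr h))
    -- the neighbour of `r` in the first triangle equals its neighbour in the second
    have h1 := adj_of_not_outer D hr1
    have h2 := adj_of_not_outer D hr2
    rcases h1 with h1 | h1 | h1 <;> rcases h2 with h2 | h2 | h2
    -- (u, a): impossible
    · exact (hau (hno r hr u a (by simp) (by simp) h1.symm h2.symm).symm).elim
    -- (u, b): `u = b`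
    · have e := hno r hr u b (by simp) (by simp) h1.symm h2.symm
      subst e
      have hvc : v ≠ c := fun h => by
        subst h; exact not_adj_both D hK huv huw hvw haw.symm hab.symm hac.symm
      have hwc : w ≠ c := fun h => by
        subst h; exact not_adj_both D hK huw huv hvw.symm hav.symm hab.symm hac.symm
      refine card_edges_le_of_hang D hK huv huw hvw hab.symm hbc hac hav.symm hvc haw.symm hwc ?_ hO1 ?_ ?_
      · intro x y z h1 h2 h3
        rcases hS x y z h1 h2 h3 with h | h | h | h | h | h <;> simp [h]
      · rw [← outer_comm₁]; exact hO2
      · intro r hr y₁ y₂ hy₁ hy₂ h1 h2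
        refine hno r ?_ y₁ y₂ ?_ ?_ h1 h2
        · rintro (h | h | h | h | h | h) <;> exact hr (by simp [h])
        · rcases hy₁ with h | h | h | h | h <;> simp [h]
        · rcases hy₂ with h | h | h | h | h <;> simp [h]
    -- (u, c): `u = c`
    · have e := hno r hr u c (by simp) (by simp) h1.symm h2.symm
      subst e
      have hvb : v ≠ b := fun h => by
        subst h; exact not_adj_both D hK huv huw hvw haw.symm hac.symm hab.symm
      have hwb : w ≠ b := fun h => by
        subst h; exact not_adj_both D hK huw huv hvw.symm hav.symm hac.symm hab.symm
      refine card_edges_le_of_hang D hK huv huw hvw hac.symm hbc.symm hab hav.symm hvb haw.symm hwb ?_ hO1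
        ?_ ?_
      · intro x y z h1 h2 h3
        rcases hS x y z h1 h2 h3 with h | h | h | h | h | h <;> simp [h]
      · rw [← outer_comm₂]; exact hO2
      · intro r hr y₁ y₂ hy₁ hy₂ h1 h2
        refine hno r ?_ y₁ y₂ ?_ ?_ h1 h2
        · rintro (h | h | h | h | h | h) <;> exact hr (by simp [h])
        · rcases hy₁ with h | h | h | h | h <;> simp [h]
        · rcases hy₂ with h | h | h | h | h <;> simp [h]
    -- (v, a): impossible
    · exact (hav (hno r hr v a (by simp) (by simp) h1.symm h2.symm).symm).elim
    -- (v, b): `v = b`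
    · have e := hno r hr v b (by simp) (by simp) h1.symm h2.symm
      subst e
      have huc : u ≠ c := fun h => by
        subst h; exact not_adj_both D hK huv.symm hvw huw haw.symm hab.symm hac.symm
      have hwc : w ≠ c := fun h => by
        subst h; exact not_adj_both D hK hvw huv.symm huw.symm hau.symm hab.symm hac.symm
      refine card_edges_le_of_hang D hK huv.symm hvw huw hab.symm hbc hac hau.symm huc haw.symm hwc ?_ ?_
        ?_ ?_
      · intro x y z h1 h2 h3
        rcases hS x y z h1 h2 h3 with h | h | h | h | h | h <;> simp [h]
      · rw [← outer_comm₁]; exact hO1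
      · rw [← outer_comm₁]; exact hO2
      · intro r hr y₁ y₂ hy₁ hy₂ h1 h2
        refine hno r ?_ y₁ y₂ ?_ ?_ h1 h2
        · rintro (h | h | h | h | h | h) <;> exact hr (by simp [h])
        · rcases hy₁ with h | h | h | h | h <;> simp [h]
        · rcases hy₂ with h | h | h | h | h <;> simp [h]
    -- (v, c): `v = c`
    · have e := hno r hr v c (by simp) (by simp) h1.symm h2.symm
      subst e
      have hub : u ≠ b := fun h => by
        subst h; exact not_adj_both D hK huv.symm hvw huw haw.symm hac.symm hab.symm
      have hwb : w ≠ b := fun h => by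
        subst h; exact not_adj_both D hK hvw huv.symm huw.symm hau.symm hac.symm hab.symm
      refine card_edges_le_of_hang D hK huv.symm hvw huw hac.symm hbc.symm hab hau.symm hub haw.symm hwb
        ?_ ?_ ?_ ?_
      · intro x y z h1 h2 h3
        rcases hS x y z h1 h2 h3 with h | h | h | h | h | h <;> simp [h]
      · rw [← outer_comm₁]; exact hO1
      · rw [← outer_comm₂]; exact hO2
      · intro r hr y₁ y₂ hy₁ hy₂ h1 h2
        refine hno r ?_ y₁ y₂ ?_ ?_ h1 h2
        · rintro (h | h | h | h | h | h) <;> exact hr (by simp [h])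
        · rcases hy₁ with h | h | h | h | h <;> simp [h]
        · rcases hy₂ with h | h | h | h | h <;> simp [h]
    -- (w, a): impossible
    · exact (haw (hno r hr w a (by simp) (by simp) h1.symm h2.symm).symm).elim
    -- (w, b): `w = b`
    · have e := hno r hr w b (by simp) (by simp) h1.symm h2.symm
      subst e
      have huc : u ≠ c := fun h => by
        subst h; exact not_adj_both D hK huw.symm hvw.symm huv hav.symm hab.symm hac.symm
      have hvc : v ≠ c := fun h => by
        subst h; exact not_adj_both D hK hvw.symm huw.symm huv.symm hau.symm hab.symm hac.symm
      refine card_edges_le_of_hang D hK huw.symm hvw.symm huv hab.symm hbc hac hau.symm huc hav.symm hvc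
        ?_ ?_ ?_ ?_
      · intro x y z h1 h2 h3
        rcases hS x y z h1 h2 h3 with h | h | h | h | h | h <;> simp [h]
      · rw [← outer_comm₂]; exact hO1
      · rw [← outer_comm₁]; exact hO2
      · intro r hr y₁ y₂ hy₁ hy₂ h1 h2
        refine hno r ?_ y₁ y₂ ?_ ?_ h1 h2
        · rintro (h | h | h | h | h | h) <;> exact hr (by simp [h])
        · rcases hy₁ with h | h | h | h | h <;> simp [h]
        · rcases hy₂ with h | h | h | h | h <;> simp [h]
    -- (w, c): `w = c`
    · have e := hno r hr w c (by simp) (by simp) h1.symm h2.symm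
      subst e
      have hub : u ≠ b := fun h => by
        subst h; exact not_adj_both D hK huw.symm hvw.symm huv hav.symm hac.symm hab.symm
      have hvb : v ≠ b := fun h => by
        subst h; exact not_adj_both D hK hvw.symm huw.symm huv.symm hau.symm hac.symm hab.symm
      refine card_edges_le_of_hang D hK huw.symm hvw.symm huv hac.symm hbc.symm hab hau.symm hub hav.symm hvb
        ?_ ?_ ?_ ?_
      · intro x y z h1 h2 h3
        rcases hS x y z h1 h2 h3 with h | h | h | h | h | h <;> simp [h]
      · rw [← outer_comm₂]; exact hO1
      · rw [← outer_comm₂]; exact hO2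
      · intro r hr y₁ y₂ hy₁ hy₂ h1 h2
        refine hno r ?_ y₁ y₂ ?_ ?_ h1 h2
        · rintro (h | h | h | h | h | h) <;> exact hr (by simp [h])
        · rcases hy₁ with h | h | h | h | h <;> simp [h]
        · rcases hy₂ with h | h | h | h | h <;> simp [h]

end C047

end TriangleCap

end PercRepro
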